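import Mathlib
import HarnessLib
import Summits.ValiantsHypothesis.ValiantsHypothesis.Theses.MonotoneRestoration
import Literature.Computability.AlgebraicComplexity.ArithCircuit
import Literature.Computability.AlgebraicComplexity.ArithCircuitProofs
import Literature.Computability.AlgebraicComplexity.MonotoneStructure
import Literature.Computability.AlgebraicComplexity.PermanentIrreducible
import Literature.ModelTheory.FiniteModelTheory.CkEquiv
import Summits.ValiantsHypothesis.ValiantsHypothesis.Theorems.MonotoneRestorationMonotoneRestorationQPCosetCount
import Summits.ValiantsHypothesis.ValiantsHypothesis.Theorems.MonotoneRestorationMonotoneRestorationQPSymmetricLB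
import Summits.ValiantsHypothesis.ValiantsHypothesis.Theorems.MonotoneRestorationMonotoneRestorationQPSupportSymmetrisation
import Summits.ValiantsHypothesis.ValiantsHypothesis.Theorems.MonotoneRestorationMonotoneRestorationQPSparseRegime
import Summits.ValiantsHypothesis.ValiantsHypothesis.Theorems.MonotoneRestorationMonotoneRestorationQPBeta
import Literature.Computability.AlgebraicComplexity.SymmetricArithCircuit
import Literature.Computability.AlgebraicComplexity.DawarWilsenach2025Proofs
import Literature.GroupTheory.PermutationGroups.SmallIndexSubgroups
import Summits.ValiantsHypothesis.ValiantsHypothesis.Theorems.MonotoneRestorationQP.Negative.LoadBearing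
import Summits.ValiantsHypothesis.ValiantsHypothesis.Theorems.MonotoneRestorationMonotoneRestorationQPPermSupportCount
import Summits.ValiantsHypothesis.ValiantsHypothesis.Theorems.MonotoneRestorationMonotoneRestorationQPGammaArithmetic

/-! TTRL-lite variant V14587 of stmt-ValiantsHypothesis-15886 -/

-- `ValiantsHypothesis.ValiantsHypothesis`: the D-0017 layout repeats the problem name in the path.
set_option linter.dupNamespace false

namespace Summit.ValiantsHypothesis.ValiantsHypothesis.Theorems

open Summit.ValiantsHypothesis.ValiantsHypothesis.Theses.MonotoneRestoration
open Literature.Computability.AlgebraicComplexity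

/-- TTRL-lite variant V14587 (`fix_nat: c := 7`) of the registered stub `stub_gammaArithmetic` of
crux item `stmt-ValiantsHypothesis-15886`: for all sufficiently large `n`, writing
`k := (Nat.log 2 n + 7) ^ 7 + 2`, one has `8 < n`, `4 k ≤ n`, `k * k ≤ n / 2`, `n / 2 + k + 9 ≤ n`
and `2 ^ ((Nat.log 2 n + 7) ^ 7) < n.choose k`.  This is the instance `c := 7` of the tree's
general statement `stub_gammaArithmetic` (file
`MonotoneRestorationMonotoneRestorationQPGammaArithmetic`), which proves it for every `c` from
`polylog_pow_lt_linear` and `permSupportCount_two_pow_le_choose`. [folklore] -/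
theorem stub_gammaArithmetic_var14587 : ∃ N : ℕ, ∀ n : ℕ, N ≤ n → 8 < n ∧ 4 * ((Nat.log 2 n + 7) ^ 7 + 2) ≤ n ∧ ((Nat.log 2 n + 7) ^ 7 + 2) * ((Nat.log 2 n + 7) ^ 7 + 2) ≤ n / 2 ∧ n / 2 + ((Nat.log 2 n + 7) ^ 7 + 2) + 9 ≤ n ∧ 2 ^ ((Nat.log 2 n + 7) ^ 7) < n.choose ((Nat.log 2 n + 7) ^ 7 + 2) :=
  stub_gammaArithmetic 7

end Summit.ValiantsHypothesis.ValiantsHypothesis.Theorems
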